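import Summits.SmoothPoincare4.SmoothPoincare4.Theses.SymplecticOrigami
import Literature.Geometry.Symplectic.SphereProdSymplecticHost

/-!
# Crux `OrigamiFoldExistence` (stmt-SmoothPoincare4-7844), split piece X₁ `HostEmbedding`:
# its formal stub `stub_sphereProdSymplecticHost` PROVED — every `ℝ⁴`-charted copy of `S² × S²` is a rational symplectic host

The strategist's birth skeleton of the split piece X₁ (`Cruxes/OrigamiFoldExistence/Lines/
split_HostEmbedding_birth.lean`, 2026-08-17) composes `HostEmbedding` (= the registered STUB 1
`stub_hostEmbedding` of line `stable-seam-host`) from two stubs: `stub_sphereProdDissolution`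
(OPEN: the fake ball embeds in a closed simply connected `X ≅ S² × S²`; ⇐ `StabOneSuffices`) and
`stub_sphereProdSymplecticHost` (formal debt: such an `X` carries a symplectic `MForm` and a
square-zero symplectic sphere pair).  Lead c9's wave landed the product symplectic `S² × S²` and
its transport along diffeomorphisms (`Literature.Geometry.Symplectic.SphereProdSymplecticForm`,
`…SphereProdSymplecticHost`, p144665/p145989), so the second stub is now a corollary: this file
proves it VERBATIM (registered on the crux item as a helper of the same name), leaving the X₁
piece with exactly one open stub, the dissolution.  The form is `Φ^*(σ ⊕ σ)` and the spheres are
`Φ⁻¹ ∘ (·, q₀)`, `Φ⁻¹ ∘ (·, −q₀)` (tree theorem `sphereProd_hostPackage_of_diffeomorph`;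
McDuff–Salamon 2017, §3.1 and Example 10.4.2 (iii)). [folklore]
-/

noncomputable section

-- the prescribed namespace `Summit.<P>.<Sub>.…` duplicates `SmoothPoincare4` (P = Sub)
set_option linter.dupNamespace false

open scoped Manifold ContDiff Topology
open Set Function

namespace Summit.SmoothPoincare4.SmoothPoincare4.Theorems.OrigamiFoldExistence.StableSeamHost

open Literature.Geometry.Symplectic

/-- A point of the round 2-sphere and its antipode are distinct: `q₀ ≠ -q₀`. [folklore] -/
private theorem pole_ne_neg_pole :
    (⟨EuclideanSpace.single 0 1, by simp⟩ : Metric.sphere (0 : EuclideanSpace ℝ (Fin 3)) 1) ≠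
      -⟨EuclideanSpace.single 0 1, by simp⟩ :=
  ne_neg_of_mem_unit_sphere ℝ _

/-- **Every closed `ℝ⁴`-charted 4-manifold diffeomorphic to `S² × S²` is a rational symplectic
host** (= `stub_sphereProdSymplecticHost` of the birth skeleton of split piece X₁
`HostEmbedding`, verbatim): it carries the chartwise smooth, closed, nondegenerate `MForm`
`Φ^*(σ ⊕ σ)` and the `Φ^*(σ ⊕ σ)`-symplectic smoothly embedded 2-sphere `Φ⁻¹ ∘ (·, q₀)` with the
disjoint homotopic embedded push-off `Φ⁻¹ ∘ (·, −q₀)` (tree theorem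
`Literature.Geometry.Symplectic.sphereProd_hostPackage_of_diffeomorph`; McDuff–Salamon 2017,
§3.1 p. 106 and Example 10.4.2 (iii)). [folklore] -/
theorem stub_sphereProdSymplecticHost :
    ∀ (X : Type) [TopologicalSpace X] [T2Space X] [SecondCountableTopology X] [CompactSpace X] [ChartedSpace (EuclideanSpace ℝ (Fin 4)) X] [IsManifold (𝓡 4) ∞ X], Nonempty (X ≃ₘ⟮𝓡 4, (𝓡 2).prod (𝓡 2)⟯ ((Metric.sphere (0 : EuclideanSpace ℝ (Fin 3)) 1) × (Metric.sphere (0 : EuclideanSpace ℝ (Fin 3)) 1))) → ∃ (Ω : Literature.Geometry.Kaehler.MForm (𝓡 4) X ℝ 2) (c c' : (Metric.sphere (0 : EuclideanSpace ℝ (Fin 3)) 1) → X), (Literature.Geometry.Kaehler.IsSmoothForm Ω ∧ Literature.Geometry.Kaehler.IsClosedForm Ω ∧ ∀ x (v : TangentSpace (𝓡 4) x), v ≠ 0 → ∃ w, Ω x ![v, w] ≠ 0) ∧ (Manifold.IsSmoothEmbedding (𝓡 2) (𝓡 4) ∞ c ∧ (∀ y (v : TangentSpace (𝓡 2) y), v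 ≠ 0 → ∃ w : TangentSpace (𝓡 2) y, Ω (c y) ![mfderiv (𝓡 2) (𝓡 4) c y v, mfderiv (𝓡 2) (𝓡 4) c y w] ≠ 0) ∧ Manifold.IsSmoothEmbedding (𝓡 2) (𝓡 4) ∞ c' ∧ Disjoint (Set.range c) (Set.range c') ∧ ∃ H : unitInterval × (Metric.sphere (0 : EuclideanSpace ℝ (Fin 3)) 1) → X, Continuous H ∧ ∀ y, H (0, y) = c y ∧ H (1, y) = c' y) := by
  intro X _ _ _ _ _ _ hΦ
  obtain ⟨Φ⟩ := hΦ
  exact ⟨hostFormOfDiffeo Φ, hostSliceOfDiffeo Φ _, hostSliceOfDiffeo Φ _,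
    sphereProd_hostPackage_of_diffeomorph Φ pole_ne_neg_pole⟩

end Summit.SmoothPoincare4.SmoothPoincare4.Theorems.OrigamiFoldExistence.StableSeamHost

end
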